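import Summits.Ventures.PercRepro.RankLevelSetPerElemThreeDual

/-! # RankLevelSetStarPlusThreeLine — THE LINE LEMMA FOR THE REFLECTION `i = 3` OF (★★)⁺ (night-1 g36; dossier
§48.9; on `RankLevelSetPerElemThreeDual`)

The per-circuit count of the reflection `A^y_3 ≤ A^y_{#E − 3}` lives in the dual `N = M✶`: for a hyperplane `H`
of `N` avoiding `y` (the complement of the circuit `K = S + y` of `y` in a member) the members are the `c ∈ H`
with `insert c S` spanning `N` and `insert y (H ∖ {c})` spanning `N`, the targets the pairs `P ⊆ H` with
`S ∪ (H ∖ P)` spanning `N` and `insert y P` spanning `N`. This module proves `#members ≤ #targets` for a rank-`≤ 2`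
flat `H` of nonloops with `4 ≤ #H` (**`line_members_le_targets`**): `insert y X` spans iff `cl X = cl H`
(`spanning_insert_iff_closure_eq`, for `X ⊆ H`, `y ∉ cl H`, `insert y H` spanning); with `A := {u ∈ H : insert u S`
spans`}` (the members lie in `A`, and parallel elements are in `A` together) either `H ⊆ A` — then the pure line
lemma `ncard_le_ncard_pairs_of_closure` applies (every member has a partner `d` with `cl {c, d} = cl H`; if every
member has two, a double count; if some member `c` has only one, `d₀`, then `H ∖ {d₀}` lies in the point of `c`,
`d₀` is no member and `c' ↦ {c', d₀}` is injective) — or some `d₀ ∈ H ∖ A` exists: then `c ↦ {c, d₀}` is injective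
on the members when `2 ≤ #A`, and when `#A ≤ 1` there is at most one member and a pair inside `H ∖ {c}` spanning
`cl H` is a target. Every declaration has a docstring; imports: the cell's own modules and Mathlib only. Axioms:
standard. -/

namespace PercRepro

open Set Matroid

variable {α : Type}

/-! ## Spanning with `y` and the closure of `H` -/

/-- For `X ⊆ H` with `y ∉ cl H` and `insert y H` spanning, `insert y X` spans iff `cl X = cl H`. -/
lemma spanning_insert_iff_closure_eq {N : Matroid α} [N.Finite] {H X : Set α} {y : α} (hHE : H ⊆ N.E)
    (hyE : y ∈ N.E) (hyH : y ∉ N.closure H) (hHy : N.Spanning (insert y H)) (hXH : X ⊆ H) :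
    N.Spanning (insert y X) ↔ N.closure X = N.closure H := by
  constructor
  · intro hs
    refine Matroid.IsRkFinite.closure_eq_closure_of_subset_of_eRk_ge_eRk
      (N.isRkFinite_of_finite (N.ground_finite.subset (hXH.trans hHE))) hXH ?_
    have h1 : N.eRk (insert y H) = N.eRk H + 1 := Matroid.eRk_insert_eq_add_one ⟨hyE, hyH⟩
    have h5 : N.eRk H + 1 ≤ N.eRk X + 1 := by
      rw [← h1, hHy.eRk_eq, ← hs.eRk_eq]
      exact N.eRk_insert_le_add_one y X
    exact (WithTop.add_le_add_iff_right (by decide)).mp h5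
  · intro hcl
    refine ⟨?_, Set.insert_subset hyE (hXH.trans hHE)⟩
    rw [← Matroid.closure_insert_closure_eq_closure_insert, hcl,
      Matroid.closure_insert_closure_eq_closure_insert]
    exact hHy.closure_eq

/-- In a flat of rank `≤ 2`, two nonloops `c`, `d` with `cl {c, d} ≠ cl H` are parallel: `d ∈ cl {c}`. -/
lemma mem_closure_singleton_of_closure_pair_ne {N : Matroid α} [N.Finite] {H : Set α} {c d : α}
    (hHE : H ⊆ N.E) (hrk : N.eRk H ≤ 2) (hc : c ∈ H) (hd : d ∈ H) (hcn : N.IsNonloop c)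
    (hne : N.closure {c, d} ≠ N.closure H) : d ∈ N.closure {c} := by
  have hsub : ({c, d} : Set α) ⊆ H := Set.pair_subset hc hd
  have hlt : N.eRk {c, d} < N.eRk H := by
    by_contra h
    push Not at h
    exact hne (Matroid.IsRkFinite.closure_eq_closure_of_subset_of_eRk_ge_eRk
      (N.isRkFinite_of_finite (Set.toFinite _)) hsub h)
  have h1 : N.eRk {c, d} ≤ 1 := by
    have h2 : N.eRk {c, d} < 2 := lt_of_lt_of_le hlt hrk
    exact Order.le_of_lt_succ h2
  have hcl : N.closure {c} = N.closure {c, d} := by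
    refine Matroid.IsRkFinite.closure_eq_closure_of_subset_of_eRk_ge_eRk
      (N.isRkFinite_of_finite (Set.toFinite _)) (Set.singleton_subset_iff.mpr (Set.mem_insert c _)) ?_
    rw [hcn.eRk_eq]
    exact h1
  rw [hcl]
  exact N.subset_closure _ (hsub.trans hHE) (Set.mem_insert_of_mem c rfl)

/-- Every nonloop `c` of a rank-`≤ 2` flat `H` with at least two elements has a partner `d ≠ c` in `H` with
`cl {c, d} = cl H`. -/
lemma exists_partner_closure_eq {N : Matroid α} [N.Finite] {H : Set α} {c : α} (hHE : H ⊆ N.E)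
    (hrk : N.eRk H ≤ 2) (hc : c ∈ H) (hcn : N.IsNonloop c) (hH2 : 2 ≤ H.ncard) :
    ∃ d ∈ H \ {c}, N.closure {c, d} = N.closure H := by
  have hHfin : H.Finite := N.ground_finite.subset hHE
  by_contra hcon
  push Not at hcon
  have hall : ∀ d ∈ H, d ∈ N.closure {c} := by
    intro d hd
    by_cases hdc : d = c
    · rw [hdc]; exact N.mem_closure_self c (hHE hc)
    · exact mem_closure_singleton_of_closure_pair_ne hHE hrk hc hd hcn (hcon d ⟨hd, hdc⟩)
  obtain ⟨d, hd⟩ : (H \ {c}).Nonempty := by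
    rw [← Set.ncard_pos (hHfin.subset Set.sdiff_subset), Set.ncard_sdiff_singleton_of_mem hc]; omega
  apply hcon d hd
  have hHc : N.closure H = N.closure {c} := by
    refine subset_antisymm (Matroid.closure_subset_closure_of_subset_closure hall) ?_
    exact N.closure_subset_closure (Set.singleton_subset_iff.mpr hc)
  refine subset_antisymm ?_ ?_
  · rw [hHc]
    exact Matroid.closure_subset_closure_of_subset_closure (fun x hx => by
      rcases hx with rfl | rfl
      · exact N.mem_closure_self x (hHE hc)
      · exact hall x hd.1)
  · exact Matroid.closure_subset_closure_of_subset_closure (fun x hx =>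
      N.closure_subset_closure (Set.singleton_subset_iff.mpr (Set.mem_insert c _)) (hall x hx))

/-! ## The pure line lemma -/

/-- **THE LINE LEMMA**: in a rank-`≤ 2` flat `H` of nonloops with `4 ≤ #H`, a set `ℳ ⊆ H` of elements `c` with
`cl (H ∖ {c}) = cl H` has at most as many elements as there are pairs `P ⊆ H` with `cl P = cl H` meeting `ℳ`. -/
theorem ncard_le_ncard_pairs_of_closure {N : Matroid α} [N.Finite] {H ℳ : Set α} (hHE : H ⊆ N.E)
    (hH4 : 4 ≤ H.ncard) (hnl : ∀ e ∈ H, N.IsNonloop e) (hrk : N.eRk H ≤ 2) (hℳ : ℳ ⊆ H)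
    (hfull : ∀ c ∈ ℳ, N.closure (H \ {c}) = N.closure H) :
    ℳ.ncard ≤ {P | P ⊆ H ∧ P.ncard = 2 ∧ N.closure P = N.closure H ∧ (P ∩ ℳ).Nonempty}.ncard := by
  classical
  have hHfin : H.Finite := N.ground_finite.subset hHE
  have hℳfin : ℳ.Finite := hHfin.subset hℳ
  set Pairs := {P | P ⊆ H ∧ P.ncard = 2 ∧ N.closure P = N.closure H ∧ (P ∩ ℳ).Nonempty} with hPairs
  have hPairsfin : Pairs.Finite := hHfin.finite_subsets.subset (fun P hP => hP.1)
  have hpair : ∀ c ∈ ℳ, ∀ d ∈ H \ {c}, N.closure {c, d} = N.closure H → ({c, d} : Set α) ∈ Pairs := by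
    intro c hc d hd hcl
    refine ⟨Set.pair_subset (hℳ hc) hd.1, Set.ncard_pair (fun h => hd.2 (by rw [Set.mem_singleton_iff]; exact h.symm)),
      hcl, ⟨c, Set.mem_insert c _, hc⟩⟩
  by_cases hB : ∀ c ∈ ℳ, ∃ d ∈ H \ {c}, ∃ d' ∈ H \ {c}, d ≠ d' ∧ N.closure {c, d} = N.closure H ∧
      N.closure {c, d'} = N.closure H
  · -- every member has two partners: double count the incidences `(c, P)`, `c ∈ P`
    set I : Finset (α × Set α) := (hℳfin.toFinset ×ˢ hPairsfin.toFinset).filter (fun p => p.1 ∈ p.2) with hI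
    have hlow : 2 * hℳfin.toFinset.card ≤ I.card := by
      refine Finset.mul_card_image_le_card_of_maps_to (f := Prod.fst) ?_ 2 ?_
      · intro p hp
        rw [hI, Finset.mem_filter, Finset.mem_product] at hp
        exact hp.1.1
      · intro c hc
        have hcℳ : c ∈ ℳ := hℳfin.mem_toFinset.mp hc
        obtain ⟨d, hd, d', hd', hdd', hcl, hcl'⟩ := hB c hcℳ
        have h1 : (c, ({c, d} : Set α)) ∈ I.filter (fun p => p.1 = c) := by
          rw [Finset.mem_filter, hI, Finset.mem_filter, Finset.mem_product]
          exact ⟨⟨⟨hc, hPairsfin.mem_toFinset.mpr (hpair c hcℳ d hd hcl)⟩, Set.mem_insert c _⟩, rfl⟩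
        have h2 : (c, ({c, d'} : Set α)) ∈ I.filter (fun p => p.1 = c) := by
          rw [Finset.mem_filter, hI, Finset.mem_filter, Finset.mem_product]
          exact ⟨⟨⟨hc, hPairsfin.mem_toFinset.mpr (hpair c hcℳ d' hd' hcl')⟩, Set.mem_insert c _⟩, rfl⟩
        have hne : (c, ({c, d} : Set α)) ≠ (c, ({c, d'} : Set α)) := by
          intro h
          have h' : ({c, d} : Set α) = {c, d'} := congrArg Prod.snd h
          exact hdd' (by
            have : d ∈ ({c, d'} : Set α) := h' ▸ Set.mem_insert_of_mem c rfl
            rcases this with h | h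
            · exact absurd h (fun h => hd.2 (by rw [Set.mem_singleton_iff]; exact h))
            · exact h)
        exact Finset.one_lt_card.mpr ⟨_, h1, _, h2, hne⟩
    have hup : I.card ≤ 2 * hPairsfin.toFinset.card := by
      refine Finset.card_le_mul_card_image_of_maps_to (f := Prod.snd) ?_ 2 ?_
      · intro p hp
        rw [hI, Finset.mem_filter, Finset.mem_product] at hp
        exact hp.1.2
      · intro P hP
        have hPPairs : P ∈ Pairs := hPairsfin.mem_toFinset.mp hP
        have hPfin : P.Finite := hHfin.subset hPPairs.1
        -- the fibre injects into `P`, which has two elements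
        calc (I.filter (fun p => p.2 = P)).card ≤ hPfin.toFinset.card := by
              refine Finset.card_le_card_of_injOn Prod.fst ?_ ?_
              · intro p hp
                rw [Finset.mem_coe, Finset.mem_filter, hI, Finset.mem_filter, Finset.mem_product] at hp
                rw [Finset.mem_coe, hPfin.mem_toFinset]
                exact hp.2 ▸ hp.1.2
              · intro p hp q hq heq
                rw [Finset.mem_coe, Finset.mem_filter] at hp hq
                exact Prod.ext heq (hp.2.trans hq.2.symm)
          _ = 2 := by rw [← Set.ncard_eq_toFinset_card P hPfin, hPPairs.2.1]
    rw [Set.ncard_eq_toFinset_card ℳ hℳfin, Set.ncard_eq_toFinset_card Pairs hPairsfin]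
    omega
  · -- some member `c` has a single partner `d₀`: `H ∖ {d₀}` is the point of `c`, and `c' ↦ {c', d₀}` injects
    push Not at hB
    obtain ⟨c, hcℳ, hone⟩ := hB
    have hcH : c ∈ H := hℳ hcℳ
    obtain ⟨d₀, hd₀, hcl₀⟩ := exists_partner_closure_eq hHE hrk hcH (hnl c hcH) (by omega)
    have hcd₀ : c ≠ d₀ := fun h => hd₀.2 (by rw [Set.mem_singleton_iff]; exact h.symm)
    have huniq : ∀ d ∈ H \ {c}, N.closure {c, d} = N.closure H → d = d₀ := by
      intro d hd hcl
      by_contra hne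
      exact hone d hd d₀ hd₀ hne hcl hcl₀
    -- every other element of `H` is parallel to `c`
    have hpar : ∀ c' ∈ H, c' ≠ d₀ → c' ∈ N.closure {c} := by
      intro c' hc' hne
      by_cases hcc : c' = c
      · rw [hcc]; exact N.mem_closure_self c (hHE hcH)
      · refine mem_closure_singleton_of_closure_pair_ne hHE hrk hcH hc' (hnl c hcH) ?_
        intro hcl
        exact hne (huniq c' ⟨hc', by simpa using hcc⟩ hcl)
    -- `d₀` is no member: `H ∖ {d₀} ⊆ cl {c}` would make `cl H = cl {c}`, against a third element
    have hd₀ℳ : d₀ ∉ ℳ := by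
      intro hd₀ℳ
      have hsub : H \ {d₀} ⊆ N.closure {c} := fun x hx => hpar x hx.1 (by simpa using hx.2)
      have hHc : N.closure H = N.closure {c} := by
        rw [← hfull d₀ hd₀ℳ]
        refine subset_antisymm (Matroid.closure_subset_closure_of_subset_closure hsub) ?_
        exact N.closure_subset_closure (Set.singleton_subset_iff.mpr ⟨hcH, by simpa using hcd₀⟩)
      obtain ⟨c', hc'⟩ : (H \ {c, d₀}).Nonempty := by
        rw [← Set.ncard_pos (hHfin.subset Set.sdiff_subset),
          Set.ncard_sdiff (Set.pair_subset hcH hd₀.1) (hHfin.subset (Set.pair_subset hcH hd₀.1)),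
          Set.ncard_pair hcd₀]
        omega
      have hc'c : c' ≠ c := fun h => hc'.2 (by rw [h]; exact Set.mem_insert c _)
      have hc'd : c' ≠ d₀ := fun h => hc'.2 (by rw [h]; exact Set.mem_insert_of_mem c rfl)
      have hcl' : N.closure {c, c'} = N.closure H := by
        rw [hHc]
        refine subset_antisymm (Matroid.closure_subset_closure_of_subset_closure (fun x hx => by
          rcases hx with rfl | rfl
          · exact N.mem_closure_self x (hHE hcH)
          · exact hpar x hc'.1 hc'd)) ?_
        exact N.closure_subset_closure (Set.singleton_subset_iff.mpr (Set.mem_insert c {c'}))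
      exact hc'd (huniq c' ⟨hc'.1, by simpa using hc'c⟩ hcl')
    -- every `c' ∈ H ∖ {d₀}` has `cl {c', d₀} = cl H`
    have hall : ∀ c' ∈ H, c' ≠ d₀ → N.closure {c', d₀} = N.closure H := by
      intro c' hc' hne
      have hc'cl : c' ∈ N.closure {c} := hpar c' hc' hne
      have hccl : c ∈ N.closure {c'} :=
        ((hnl c hcH).mem_closure_comm (hnl c' hc')).mp hc'cl
      refine subset_antisymm (N.closure_subset_closure (Set.pair_subset hc' hd₀.1)) ?_
      rw [← hcl₀]
      refine Matroid.closure_subset_closure_of_subset_closure (fun x hx => by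
        rcases hx with rfl | rfl
        · exact N.closure_subset_closure (Set.singleton_subset_iff.mpr (Set.mem_insert c' _)) hccl
        · exact N.subset_closure _ (Set.pair_subset hc' hd₀.1 |>.trans hHE) (Set.mem_insert_of_mem c' rfl))
    refine Set.ncard_le_ncard_of_injOn (fun c' => ({c', d₀} : Set α)) ?_ ?_ hPairsfin
    · intro c' hc'
      have hne : c' ≠ d₀ := fun h => hd₀ℳ (h ▸ hc')
      exact hpair c' hc' d₀ ⟨hd₀.1, by simpa using hne.symm⟩ (hall c' (hℳ hc') hne)
    · intro c₁ hc₁ c₂ hc₂ heq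
      have h1 : c₁ ≠ d₀ := fun h => hd₀ℳ (h ▸ hc₁)
      have h2 : c₂ ≠ d₀ := fun h => hd₀ℳ (h ▸ hc₂)
      have heq' : ({c₁, d₀} : Set α) = {c₂, d₀} := heq
      have : c₁ ∈ ({c₂, d₀} : Set α) := heq' ▸ Set.mem_insert c₁ _
      rcases this with h | h
      · exact h
      · exact absurd h h1

/-! ## The members and the targets of one hyperplane -/

/-- Parallel elements are `S`-full together: if `insert c S` spans and `d ∈ cl {c}` with `c ∈ cl {d}`, then
`insert d S` spans. -/
lemma spanning_insert_of_mem_closure_singleton {N : Matroid α} {S : Set α} {c d : α} (hSE : S ⊆ N.E)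
    (hdE : d ∈ N.E) (hcd : c ∈ N.closure {d}) (hs : N.Spanning (insert c S)) : N.Spanning (insert d S) := by
  refine ⟨?_, Set.insert_subset hdE hSE⟩
  have h1 : c ∈ N.closure (insert d S) :=
    N.closure_subset_closure (Set.singleton_subset_iff.mpr (Set.mem_insert d S)) hcd
  rw [← Matroid.closure_insert_eq_of_mem_closure h1]
  exact hs.closure_eq_of_superset (Set.insert_subset_insert (Set.subset_insert d S))

/-- **THE MEMBERS OF A HYPERPLANE ARE AT MOST ITS TARGETS**: for a flat `H ⊆ N.E` of rank `≤ 2` consisting of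
nonloops, with `4 ≤ #H`, `y ∉ cl H`, `insert y H` spanning, and any `S ⊆ N.E`,
`#{c ∈ H : insert c S spans ∧ insert y (H ∖ {c}) spans} ≤ #{P ⊆ H : #P = 2 ∧ S ∪ (H ∖ P) spans ∧ insert y P spans}`.
-/
theorem line_members_le_targets {N : Matroid α} [N.Finite] {H S : Set α} {y : α} (hHE : H ⊆ N.E)
    (hSE : S ⊆ N.E) (hyE : y ∈ N.E) (hyH : y ∉ N.closure H) (hHy : N.Spanning (insert y H))
    (hH4 : 4 ≤ H.ncard) (hnl : ∀ e ∈ H, N.IsNonloop e) (hrk : N.eRk H ≤ 2) :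
    {c ∈ H | N.Spanning (insert c S) ∧ N.Spanning (insert y (H \ {c}))}.ncard ≤
      {P | P ⊆ H ∧ P.ncard = 2 ∧ N.Spanning (S ∪ (H \ P)) ∧ N.Spanning (insert y P)}.ncard := by
  have hHfin : H.Finite := N.ground_finite.subset hHE
  set ℳ := {c ∈ H | N.Spanning (insert c S) ∧ N.Spanning (insert y (H \ {c}))} with hℳ
  set 𝒯 := {P | P ⊆ H ∧ P.ncard = 2 ∧ N.Spanning (S ∪ (H \ P)) ∧ N.Spanning (insert y P)} with h𝒯
  set A := {u ∈ H | N.Spanning (insert u S)} with hA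
  have hℳH : ℳ ⊆ H := fun c hc => hc.1
  have hℳA : ℳ ⊆ A := fun c hc => ⟨hc.1, hc.2.1⟩
  have hAH : A ⊆ H := fun u hu => hu.1
  have h𝒯fin : 𝒯.Finite := hHfin.finite_subsets.subset (fun P hP => hP.1)
  -- `insert y X` spans iff `cl X = cl H`, for `X ⊆ H`
  have hiff : ∀ X ⊆ H, (N.Spanning (insert y X) ↔ N.closure X = N.closure H) :=
    fun X hX => spanning_insert_iff_closure_eq hHE hyE hyH hHy hX
  have hfull : ∀ c ∈ ℳ, N.closure (H \ {c}) = N.closure H :=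
    fun c hc => (hiff _ Set.sdiff_subset).mp hc.2.2
  by_cases hHA : H ⊆ A
  · -- every element is `S`-full: the pure line lemma
    refine (ncard_le_ncard_pairs_of_closure hHE hH4 hnl hrk hℳH hfull).trans (Set.ncard_le_ncard ?_ h𝒯fin)
    rintro P ⟨hPH, hP2, hPcl, -⟩
    refine ⟨hPH, hP2, ?_, (hiff P hPH).mpr hPcl⟩
    obtain ⟨u, hu⟩ : (H \ P).Nonempty := by
      rw [← Set.ncard_pos (hHfin.subset Set.sdiff_subset), Set.ncard_sdiff hPH (hHfin.subset hPH), hP2]; omega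
    exact (hHA hu.1).2.superset (Set.insert_subset (Set.mem_union_right S hu) Set.subset_union_left)
      (Set.union_subset hSE (Set.sdiff_subset.trans hHE))
  · rw [Set.not_subset] at hHA
    obtain ⟨d₀, hd₀H, hd₀A⟩ := hHA
    have hd₀S : ¬ N.Spanning (insert d₀ S) := fun h => hd₀A ⟨hd₀H, h⟩
    rcases Nat.lt_or_ge A.ncard 2 with hA1 | hA2
    · -- at most one member; one target inside `H ∖ {c}`
      have hℳ1 : ℳ.ncard ≤ 1 := (Set.ncard_le_ncard hℳA (hHfin.subset hAH)).trans (by omega)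
      rcases Nat.eq_zero_or_pos ℳ.ncard with h0 | hpos
      · rw [h0]; exact Nat.zero_le _
      obtain ⟨c, hc⟩ := (Set.ncard_pos (hHfin.subset hℳH)).mp hpos
      -- a basis of `H ∖ {c}` in `N` has at most two elements; extend it to a pair inside `H ∖ {c}`
      obtain ⟨B, hB⟩ := N.exists_isBasis (H \ {c}) (Set.sdiff_subset.trans hHE)
      have hBfin : B.Finite := hHfin.subset (hB.subset.trans Set.sdiff_subset)
      have hB2 : B.ncard ≤ 2 := by
        have h1 : N.eRk (H \ {c}) = B.encard := hB.eRk_eq_encard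
        have h2 : N.eRk (H \ {c}) ≤ 2 := (N.eRk_mono Set.sdiff_subset).trans hrk
        have h3 : ((B.ncard : ℕ) : ℕ∞) ≤ ((2 : ℕ) : ℕ∞) := by
          rw [hBfin.cast_ncard_eq, ← h1]; exact h2
        exact_mod_cast h3
      obtain ⟨P, hBP, hPc, hP2⟩ := Set.exists_subsuperset_card_eq hB.subset hB2
        (by rw [Set.ncard_sdiff_singleton_of_mem hc.1]; omega)
      have hPH : P ⊆ H := hPc.trans Set.sdiff_subset
      have hPcl : N.closure P = N.closure H := by
        rw [← hfull c hc]
        refine subset_antisymm (N.closure_subset_closure hPc) ?_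
        rw [← hB.closure_eq_closure]
        exact N.closure_subset_closure hBP
      have hP𝒯 : P ∈ 𝒯 := by
        refine ⟨hPH, hP2, ?_, (hiff P hPH).mpr hPcl⟩
        have hcP : c ∈ H \ P := ⟨hc.1, fun h => (hPc h).2 (Set.mem_singleton c)⟩
        exact hc.2.1.superset (Set.insert_subset (Set.mem_union_right S hcP) Set.subset_union_left)
          (Set.union_subset hSE (Set.sdiff_subset.trans hHE))
      calc ℳ.ncard ≤ 1 := hℳ1
        _ ≤ 𝒯.ncard := (Set.ncard_pos h𝒯fin).mpr ⟨P, hP𝒯⟩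
    · -- `2 ≤ #A`: `c ↦ {c, d₀}` injects the members into the targets
      refine Set.ncard_le_ncard_of_injOn (fun c => ({c, d₀} : Set α)) ?_ ?_ h𝒯fin
      · intro c hc
        have hcH : c ∈ H := hc.1
        have hcd : c ≠ d₀ := fun h => hd₀S (h ▸ hc.2.1)
        -- `d₀ ∉ cl {c}`: otherwise `d₀` would be `S`-full with `c`
        have hd₀cl : d₀ ∉ N.closure {c} := by
          intro hd₀cl
          exact hd₀S (spanning_insert_of_mem_closure_singleton hSE (hHE hd₀H)
            (((hnl d₀ hd₀H).mem_closure_comm (hnl c hcH)).mpr hd₀cl) hc.2.1)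
        have hcl : N.closure {c, d₀} = N.closure H := by
          refine Matroid.IsRkFinite.closure_eq_closure_of_subset_of_eRk_ge_eRk
            (N.isRkFinite_of_finite (Set.toFinite _)) (Set.pair_subset hcH hd₀H) ?_
          rw [Set.pair_comm, Matroid.eRk_insert_eq_add_one ⟨hHE hd₀H, hd₀cl⟩, (hnl c hcH).eRk_eq]
          exact hrk
        refine ⟨Set.pair_subset hcH hd₀H, Set.ncard_pair hcd, ?_, (hiff _ (Set.pair_subset hcH hd₀H)).mpr hcl⟩
        -- a second `S`-full element `u ≠ c` lies outside `{c, d₀}`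
        obtain ⟨u, huA, huc⟩ : ∃ u ∈ A, u ≠ c := by
          by_contra hcon
          push Not at hcon
          have : A ⊆ {c} := fun u hu => by rw [Set.mem_singleton_iff]; exact hcon u hu
          have := Set.ncard_le_ncard this (Set.finite_singleton c)
          rw [Set.ncard_singleton] at this
          omega
        have hud : u ≠ d₀ := fun h => hd₀A (h ▸ huA)
        have huHP : u ∈ H \ {c, d₀} := ⟨huA.1, by simp only [Set.mem_insert_iff, Set.mem_singleton_iff, not_or]; exact ⟨huc, hud⟩⟩
        exact huA.2.superset (Set.insert_subset (Set.mem_union_right S huHP) Set.subset_union_left)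
          (Set.union_subset hSE (Set.sdiff_subset.trans hHE))
      · intro c₁ hc₁ c₂ hc₂ heq
        have h1 : c₁ ≠ d₀ := fun h => hd₀S (h ▸ hc₁.2.1)
        have heq' : ({c₁, d₀} : Set α) = {c₂, d₀} := heq
        have : c₁ ∈ ({c₂, d₀} : Set α) := heq' ▸ Set.mem_insert c₁ _
        rcases this with h | h
        · exact h
        · exact absurd h h1

end PercRepro
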